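import Literature.MathematicalPhysics.QuantumFieldTheory.Balaban1983to89.Beta.RootedComb
import Literature.MathematicalPhysics.QuantumFieldTheory.Balaban1983to89.Beta.AffineReproduction

/-!
# The BLOCK-MEAN-normalised rooted axial projector and the averaging constraint: `contourSum` of `axProjAt ρ` vs `axProjBmAt ρ`
# (β sub-cell, row BETA-an2, gen 12; kernel anchor of NOTE X-an2-42)

HONEST FRAMING (cell charter, verbatim): «discharging BetaPertH makes Balaban's UV stability UNCONDITIONAL — a real
constructive-QFT result; it is NOT the continuum limit and NOT the Clay problem.»  DERIVED cell leaf; no statement of Bałaban's papers is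
typed here, no `[cite:]` tag, no `Prop` fact; it instantiates no binder of the β-function wall by itself.  NOT `BetaPertH`; NOT continuum;
NOT Clay.  It records, as kernel-checked identities about the CELL'S OWN typed objects, the mechanism behind NOTE X-an2-42 (which axial
projector may dress a resolvent whose constraint is the STRAIGHT block average `contourSum`).

## What is here

* §1 `blockMeanAt N f` (the block mean of a 0-form, read at a fine point through its block), `bmGaugeAt ρ A N := treeGaugeAt ρ A N − blockMeanAt N
  (treeGaugeAt ρ A N)` (the rooted tree gauge RE-NORMALISED to zero block means), the projector **`axProjBmAt ρ N A := A − grad (bmGaugeAt ρ A N)`**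
  and `axProjBmAt_eq : axProjBmAt ρ N A = axProjAt ρ N A + grad (blockMeanAt N (treeGaugeAt ρ A N))`.
* §2 THE DICHOTOMY on the straight averaging (`AffineAveraging.contourSum_dz` BY NAME):
  **`contourSum_axProjAt : contourSum N (axProjAt ρ N A) = contourSum N A − dz (blockSum N (treeGaugeAt ρ A N))`** — the comb-ROOT-normalised
  projector changes the straight block averages by the coarse gradient of the block sums of the tree gauge; and
  **`contourSum_axProjBmAt : contourSum N (axProjBmAt ρ N A) = contourSum N A`** — the block-MEAN-normalised one preserves them
  (`blockSum` of a block-mean-free function vanishes).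
* §3 `axProjBmAt` lands in the rooted axial gauge and fixes it: `axialGaugeAt_axProjBmAt`, `axProjBmAt_eq_self_of_axialGaugeAt`, `axProjBmAt_idem`
  (in-block root; `RootedComb.axialGaugeAt_axProjAt` / `treeGaugeAt_eq_zero_of_axialGaugeAt` BY NAME + «the axial contour of the gradient of a
  block-constant function inside one block sums to zero»).

WHY (X-an2-42).  The slice-change identity `Γ_P = Π Γ_τ Πᵀ` (`GaugeFixingPropagators.kktInv_sliceChange`, `SliceComposition`) needs the averaging to be
blind to the gauge directions defining `Π`.  §2 shows: for the constraint `contourSum` those are the gradients of λ's with block-constant block sums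
— the `axProjBmAt` directions — and NOT the root-vanishing λ's of `axProjAt`.  Nothing here decides which projector the wall family should use; that is
the β-lead's ruling (R42-1).  All declarations `[folklore]`; axioms standard.
Provenance: b2b-balaban β sub-cell, unit beta-an2 gen 12, 2026-08-19 (v1); over an1's `AveragingContours(Rooted)`, an5's `RootedComb`, the lead's
`AffineAveraging`/`AffineReproduction` BY NAME; no existing file touched.
-/

open Finset
open scoped BigOperators
open Literature.MathematicalPhysics.QuantumFieldTheory
open Literature.MathematicalPhysics.QuantumFieldTheory.Balaban1983to89
open Literature.MathematicalPhysics.QuantumFieldTheory.Balaban1983to89.Beta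
open AffineAveraging (Form0 Form1 box toSite unitVec unitVec_apply dz blockSum contourSum contourSum_dz)
open AffineReproduction (contourSum_sub contourSum_add)
open AveragingContours (blk grad axial axial_sum_grad grad_eq_dz blk_add_off off off_mem_box)
open AveragingContoursRooted (treeGaugeAt AxialGaugeAt)
open RootedComb (axProjAt axProjAt_apply axialGaugeAt_axProjAt treeGaugeAt_eq_zero_of_axialGaugeAt)
open AxialProjector (blk_add_zsmul)

namespace Summit.QuantumFields.BalabanUV.Beta.AxialProjectorBlockMean

noncomputable section

variable {n : ℕ}

/-! ## §1 The block-mean-normalised tree gauge and projector -/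

/-- [folklore] The BLOCK MEAN of a 0-form, read at a fine point through its block: `(blockSum N f (blk N x)) / N^n`. -/
def blockMeanAt (N : ℕ) (f : Form0 n ℝ) : Form0 n ℝ := fun x => blockSum N f (blk N x) / ((N : ℝ) ^ n)

/-- [folklore] The rooted tree gauge re-normalised to ZERO BLOCK MEANS. -/
def bmGaugeAt (ρ : Fin n → ℤ) (A : Form1 n ℝ) (N : ℕ) : Form0 n ℝ := treeGaugeAt ρ A N - blockMeanAt N (treeGaugeAt ρ A N)

/-- [folklore] **THE BLOCK-MEAN-NORMALISED ROOTED AXIAL PROJECTOR** `Π^ρ_bm A := A − grad (bmGaugeAt ρ A N)`. -/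
def axProjBmAt (ρ : Fin n → ℤ) (N : ℕ) (A : Form1 n ℝ) : Form1 n ℝ := A - grad (bmGaugeAt ρ A N)

/-- [folklore] `grad` is additive-group linear: `grad (f − g) = grad f − grad g`. -/
theorem grad_sub (f g : Form0 n ℝ) : grad (f - g) = grad f - grad g := by
  funext κ x; simp only [grad, Pi.sub_apply]; ring

/-- [folklore] `Π_bm = Π_root + grad (block mean of the tree gauge)`. -/
theorem axProjBmAt_eq (ρ : Fin n → ℤ) (N : ℕ) (A : Form1 n ℝ) :
    axProjBmAt ρ N A = axProjAt ρ N A + grad (blockMeanAt N (treeGaugeAt ρ A N)) := by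
  unfold axProjBmAt bmGaugeAt
  rw [grad_sub, axProjAt]
  abel

/-! ## §2 The straight block averages under the two projectors -/

/-- [folklore] **ROOT NORMALISATION BREAKS THE STRAIGHT AVERAGES**: `𝒬 (Π_root A) = 𝒬 A − dz (blockSum (λ^ρ_A))`. -/
theorem contourSum_axProjAt (ρ : Fin n → ℤ) (N : ℕ) (A : Form1 n ℝ) :
    contourSum N (axProjAt ρ N A) = contourSum N A - dz (blockSum N (treeGaugeAt ρ A N)) := by
  rw [axProjAt, contourSum_sub, grad_eq_dz, contourSum_dz]

/-- [folklore] The block sum of the block mean (as a function of the fine point) is the block sum (`N ≥ 1`). -/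
theorem blockSum_blockMeanAt {N : ℕ} (hN : 1 ≤ N) (f : Form0 n ℝ) (y : Fin n → ℤ) :
    blockSum N (blockMeanAt N f) y = blockSum N f y := by
  have hblk : ∀ b ∈ box n N, blk N ((N : ℤ) • y + toSite b) = y := fun b hb => AveragingContours.blk_block y hb
  have hcard : (box n N).card = N ^ n := by
    simp only [AffineAveraging.box, Fintype.card_piFinset, Finset.card_range, Finset.prod_const, Finset.card_univ,
      Fintype.card_fin]
  have hNn : ((N : ℝ) ^ n) ≠ 0 := pow_ne_zero _ (by exact_mod_cast (show N ≠ 0 by omega))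
  show ∑ b ∈ box n N, blockMeanAt N f ((N : ℤ) • y + toSite b) = blockSum N f y
  simp only [blockMeanAt]
  rw [Finset.sum_congr rfl fun b hb => by rw [hblk b hb], Finset.sum_const, hcard, nsmul_eq_mul]
  push_cast
  field_simp

/-- [folklore] A block-mean-free function has vanishing block sums. -/
theorem blockSum_sub_blockMeanAt {N : ℕ} (hN : 1 ≤ N) (f : Form0 n ℝ) : blockSum N (f - blockMeanAt N f) = 0 := by
  funext y
  have h : blockSum N (f - blockMeanAt N f) y = blockSum N f y - blockSum N (blockMeanAt N f) y := by
    simp only [blockSum, Pi.sub_apply, Finset.sum_sub_distrib]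
  rw [h, blockSum_blockMeanAt hN, sub_self]
  rfl

/-- [folklore] **BLOCK-MEAN NORMALISATION PRESERVES THE STRAIGHT AVERAGES**: `𝒬 (Π_bm A) = 𝒬 A` (`N ≥ 1`). -/
theorem contourSum_axProjBmAt (ρ : Fin n → ℤ) {N : ℕ} (hN : 1 ≤ N) (A : Form1 n ℝ) :
    contourSum N (axProjBmAt ρ N A) = contourSum N A := by
  unfold axProjBmAt bmGaugeAt
  rw [contourSum_sub, grad_eq_dz, contourSum_dz, blockSum_sub_blockMeanAt hN]
  have h0 : dz (0 : Form0 n ℝ) = 0 := by funext κ x; simp [dz]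
  rw [h0, sub_zero]

/-! ## §3 `Π_bm` lands in the rooted axial gauge and is the identity there -/

/-- [folklore] Inside one block the axial contour of the gradient of a function that is CONSTANT ON BLOCKS sums to zero. -/
theorem axial_sum_grad_blockConst {N : ℕ} {r : Fin n → ℕ} (hr : r ∈ box n N) (g : Form0 n ℝ) (hg : ∀ x, g x = g ((N : ℤ) • blk N x))
    (y : Fin n → ℤ) {b : Fin n → ℕ} (hb : b ∈ box n N) :
    (axial (grad g) ((N : ℤ) • y + toSite r) ((N : ℤ) • y + toSite b)).sum = 0 := by
  rw [axial_sum_grad, hg ((N : ℤ) • y + toSite b), hg ((N : ℤ) • y + toSite r), AveragingContours.blk_block y hb,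
    AveragingContours.blk_block y hr, sub_self]

/-- [folklore] `blockMeanAt` is constant on blocks. -/
theorem blockMeanAt_blockConst (N : ℕ) (f : Form0 n ℝ) {L : ℕ} (hL : L = N) (hN : 1 ≤ N) (x : Fin n → ℤ) :
    blockMeanAt N f x = blockMeanAt N f ((N : ℤ) • blk N x) := by
  subst hL
  unfold blockMeanAt
  rw [show blk L ((L : ℤ) • blk L x) = blk L x from by
    have := AveragingContours.blk_block (L := L) (blk L x) (b := fun _ => 0)
      (Fintype.mem_piFinset.2 fun _ => Finset.mem_range.2 (by omega))
    simpa [toSite] using this]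

/-- [folklore] **`Π_bm` LANDS IN THE ROOTED AXIAL GAUGE** (in-block root): `AxialGaugeAt ρ (Π^ρ_bm A) N`. -/
theorem axialGaugeAt_axProjBmAt {N : ℕ} (hN : 1 ≤ N) {r : Fin n → ℕ} (hr : r ∈ box n N) (A : Form1 n ℝ) :
    AxialGaugeAt (toSite r) (axProjBmAt (toSite r) N A) N := by
  intro y b hb
  rw [axProjBmAt_eq]
  have h1 := axialGaugeAt_axProjAt hr A y b hb
  have hadd : (axial (axProjAt (toSite r) N A + grad (blockMeanAt N (treeGaugeAt (toSite r) A N))) ((N : ℤ) • y + toSite r)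
      ((N : ℤ) • y + toSite b)).sum = (axial (axProjAt (toSite r) N A) ((N : ℤ) • y + toSite r) ((N : ℤ) • y + toSite b)).sum +
      (axial (grad (blockMeanAt N (treeGaugeAt (toSite r) A N))) ((N : ℤ) • y + toSite r) ((N : ℤ) • y + toSite b)).sum := by
    have h := AveragingContours.axial_sum_sub (axProjAt (toSite r) N A + grad (blockMeanAt N (treeGaugeAt (toSite r) A N)))
      (grad (blockMeanAt N (treeGaugeAt (toSite r) A N))) ((N : ℤ) • y + toSite r) ((N : ℤ) • y + toSite b)
    rw [add_sub_cancel_right] at h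
    linarith
  rw [hadd, h1, zero_add]
  exact axial_sum_grad_blockConst hr _ (fun x => blockMeanAt_blockConst N _ rfl hN x) y hb

/-- [folklore] **`Π_bm` IS THE IDENTITY ON THE ROOTED AXIAL GAUGE** (in-block root). -/
theorem axProjBmAt_eq_self_of_axialGaugeAt {N : ℕ} (hN : 1 ≤ N) {r : Fin n → ℕ} {A : Form1 n ℝ}
    (hA : AxialGaugeAt (toSite r) A N) : axProjBmAt (toSite r) N A = A := by
  unfold axProjBmAt bmGaugeAt
  rw [treeGaugeAt_eq_zero_of_axialGaugeAt hN hA]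
  have h0 : blockMeanAt N (0 : Form0 n ℝ) = 0 := by funext x; simp [blockMeanAt, blockSum]
  rw [h0, sub_zero]
  have hg : grad (0 : Form0 n ℝ) = 0 := by funext κ x; simp [grad]
  rw [hg, sub_zero]

/-- [folklore] **`Π_bm` IS IDEMPOTENT** (in-block root). -/
theorem axProjBmAt_idem {N : ℕ} (hN : 1 ≤ N) {r : Fin n → ℕ} (hr : r ∈ box n N) (A : Form1 n ℝ) :
    axProjBmAt (toSite r) N (axProjBmAt (toSite r) N A) = axProjBmAt (toSite r) N A :=
  axProjBmAt_eq_self_of_axialGaugeAt hN (axialGaugeAt_axProjBmAt hN hr A)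

end

end Summit.QuantumFields.BalabanUV.Beta.AxialProjectorBlockMean
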